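import Summits.Ventures.HSemireg.WedgeHankelRecurrenceGaussResultantCommonFactor

/-!
# Venture HSemireg — **THE MIXED RESULTANT TWO STEPS APART, `Res(T_{n+2}, U_n)`** (Mathlib's Chebyshev polynomials over `ℤ`): from `2T_{n+2} = U_{n+2} − U_n` (Mathlib) and N430,
# **`Res_{(n+2,n)}(T_{n+2}, U_n) = U_n(0) · (−1)^{n(n+1)∕2} 2^{n(n+1)}`** — zero for odd `n`, `(−1)^m (−1)^{m(2m+1)} 2^{2m(2m+1)}` for `n = 2m`; over a field with `2 ≠ 0`, **`T_{n+2}` and `U_n`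
# share a zero iff `n` is odd**

HONEST FRAMING. Part of the Lean index of the computation cell `pub-hsemireg` (seat p10 gen 47, Sunday typer «UNIFORM-IN-n»).  Integer polynomial algebra and evaluation only (Mathlib
`Polynomial.resultant`, `Polynomial.Chebyshev`); no variety, no cohomology theory, no sheaf, no Ext group and no semiregularity map is constructed here; nothing here says that HC / HC_CM /
HC_AV holds; no Literature fact (unproved `Prop`) is declared or used.  Custodian versions as in `WedgeHankelSiegelIdeal` (1/3).
SOURCES (cited).  K. Dilcher, K. B. Stolarsky, Trans. Amer. Math. Soc. 357 (2005) 965–981, §3 (mixed resultants `Res(T_m, U_n)`); D. P. Jacobs, M. O. Rayes, V. Trevisan, Canad. Math. Bull. 54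
(2011) 288–296.  The displayed case is the COROLLARY typed here of N430.
PROOF TYPED HERE.  `Res(C 2 · T_{n+2}, U_n) = 2^n Res(T_{n+2}, U_n)` (`resultant_C_mul_left`) and `C 2 · T_{n+2} = U_{n+2} + U_n · (−1)` (Mathlib `two_mul_T_eq_U_sub_U`, `resultant_add_mul_left`),
N430 `chebyshevU_resultant_gap_two`, cancellation of `2^n` in `ℤ`; N431 `chebyshevU_common_zero_gap_two_iff`.
DEDUP DISCLOSURE (`rg -n -i 'chebyshevTU_resultant_gap|TU_common_zero_gap' Summits/Ventures/HSemireg`, 2026-09-04): N432 (indices `(n+2, n+1)` and `(n+1, n+1)`); 0 hits for the 4 names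
below.

WHAT IS IN THE TREE.  N430 `chebyshevU_resultant_gap_two`; N431 `chebyshevU_common_zero_gap_two_iff`; N432 `chebyshevTU_resultant_succ`, `chebyshevTU_resultant_same`; Mathlib
`two_mul_T_eq_U_sub_U`, `U_eval_zero_of_odd`, `U_eval_two_mul_zero`.
THIS FILE (namespace `Summit.Ventures.HSemireg.Wedge.HankelOuter` continued; CHAINED on N439; 0 definitions):
* §1205 **`chebyshevTU_resultant_gap_two`**, `chebyshevTU_resultant_gap_two_odd` (`= 0`), `chebyshevTU_resultant_gap_two_even`, **`chebyshevTU_common_zero_gap_two_iff`**.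
CAVEATS.  Formal degrees explicit.  Nothing Ext-side.  New names only.
-/

open Module Polynomial
open scoped Matrix Polynomial

namespace Summit.Ventures.HSemireg.Wedge.HankelOuter

/-! ## §1205. `Res(T_{n+2}, U_n)` -/

/-- **`Res_{(n+2,n)}(T_{n+2}, U_n) = U_n(0) · (−1)^{n(n+1)∕2} 2^{n(n+1)}`** over `ℤ`. [Dilcher–Stolarsky 2005 §3; this file, §1205] -/
theorem chebyshevTU_resultant_gap_two (n : ℕ) :
    (Polynomial.Chebyshev.T ℤ ((n : ℤ) + 2)).resultant (Polynomial.Chebyshev.U ℤ (n : ℤ)) (n + 2) n =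
      (Polynomial.Chebyshev.U ℤ (n : ℤ)).eval 0 * ((-1) ^ (n * (n + 1) / 2) * 2 ^ (n * (n + 1))) := by
  obtain ⟨hdn, -⟩ := chebyshevU_natDegree_coeff n
  have h1 : C (2 : ℤ) * Polynomial.Chebyshev.T ℤ ((n : ℤ) + 2) = Polynomial.Chebyshev.U ℤ ((n : ℤ) + 2) + Polynomial.Chebyshev.U ℤ (n : ℤ) * C (-1 : ℤ) := by
    rw [show C (2 : ℤ) = (2 : ℤ[X]) from map_ofNat C 2, Polynomial.Chebyshev.two_mul_T_eq_U_sub_U, map_neg, map_one]; ring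
  have key : (C (2 : ℤ) * Polynomial.Chebyshev.T ℤ ((n : ℤ) + 2)).resultant (Polynomial.Chebyshev.U ℤ (n : ℤ)) (n + 2) n =
      2 ^ n * ((Polynomial.Chebyshev.U ℤ (n : ℤ)).eval 0 * ((-1) ^ (n * (n + 1) / 2) * 2 ^ (n * (n + 1)))) := by
    rw [h1, resultant_add_mul_left _ _ _ _ _ (by rw [natDegree_C]; omega) hdn.le, chebyshevU_resultant_gap_two, mul_assoc]
  rw [resultant_C_mul_left] at key
  exact mul_left_cancel₀ (pow_ne_zero n two_ne_zero) key

/-- Odd index: `Res_{(2m+3,2m+1)}(T_{2m+3}, U_{2m+1}) = 0`. [this file, §1205] -/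
theorem chebyshevTU_resultant_gap_two_odd (m : ℕ) :
    (Polynomial.Chebyshev.T ℤ (((2 * m + 1 : ℕ) : ℤ) + 2)).resultant (Polynomial.Chebyshev.U ℤ ((2 * m + 1 : ℕ) : ℤ)) (2 * m + 1 + 2) (2 * m + 1) = 0 := by
  rw [chebyshevTU_resultant_gap_two (2 * m + 1), Polynomial.Chebyshev.U_eval_zero_of_odd (R := ℤ) (n := ((2 * m + 1 : ℕ) : ℤ)) ⟨m, by push_cast; ring⟩, zero_mul]

/-- Even index: `Res_{(2m+2,2m)}(T_{2m+2}, U_{2m}) = (−1)^m · (−1)^{m(2m+1)} 2^{2m(2m+1)}` (`U_{2m}(0) = (−1)^m`). [this file, §1205] -/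
theorem chebyshevTU_resultant_gap_two_even (m : ℕ) :
    (Polynomial.Chebyshev.T ℤ (((2 * m : ℕ) : ℤ) + 2)).resultant (Polynomial.Chebyshev.U ℤ ((2 * m : ℕ) : ℤ)) (2 * m + 2) (2 * m) =
      (-1) ^ m * ((-1) ^ (2 * m * (2 * m + 1) / 2) * 2 ^ (2 * m * (2 * m + 1))) := by
  rw [chebyshevTU_resultant_gap_two (2 * m), show (((2 * m : ℕ) : ℤ)) = 2 * (m : ℤ) by push_cast; ring, Polynomial.Chebyshev.U_eval_two_mul_zero, Int.coe_negOnePow_natCast]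
  simp only [Int.cast_id]

/-- **`T_{n+2}` and `U_n` have a common zero iff `n` is odd** (field with `2 ≠ 0`; the common zero is `0`). [corollary via `2T_{n+2} = U_{n+2} − U_n` and N431; this file, §1205] -/
theorem chebyshevTU_common_zero_gap_two_iff {K : Type*} [Field K] (h2 : (2 : K) ≠ 0) (n : ℕ) :
    (∃ x : K, (Polynomial.Chebyshev.T K ((n : ℤ) + 2)).eval x = 0 ∧ (Polynomial.Chebyshev.U K (n : ℤ)).eval x = 0) ↔ Odd n := by
  rw [← chebyshevU_common_zero_gap_two_iff h2 n]
  refine exists_congr fun x => ?_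
  have e := congrArg (Polynomial.eval x) (Polynomial.Chebyshev.two_mul_T_eq_U_sub_U K (n : ℤ))
  rw [eval_mul, eval_ofNat, eval_sub] at e
  constructor
  · rintro ⟨hT, hU⟩
    exact ⟨by linear_combination -e + 2 * hT + hU, hU⟩
  · rintro ⟨hU2, hU⟩
    have h : (2 : K) * (Polynomial.Chebyshev.T K ((n : ℤ) + 2)).eval x = 0 := by linear_combination e + hU2 - hU
    exact ⟨(mul_eq_zero.1 h).resolve_left h2, hU⟩

end Summit.Ventures.HSemireg.Wedge.HankelOuter
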